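import Summits.Ventures.Crystal3D.Theorems.StickyWulffConstantCoaxialWallLawSeamFullCensusKit
import HarnessLib

/-!
# FULL-CENSUS CHECKER: the certificate language and the executable checker of the E1 cascade (definitions only)
# (crux `CoaxialWallLaw`, stmt-Ventures-19481; lane F 'Certificates' v8.4, registered stub `stub_satCensus11Full : TailResidue.SatCensus11Full`)

HONEST FRAMING. Venture `Summits/Ventures/Crystal3D` (cell `crystal3d-full`); helper for `stub_satCensus11Full`; sequel of '…SeamFullCensusKit'.  Pure
definitions (computable, kernel-reducible): rational triples `Q3` (the `√18`-model of '…EndRowRatFrames' in a structure, `toV` back to `Fin 3 → ℚ`),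
the frame tables of a reflection chain (`tabs κ`, the computable twin of `RatFrame.base.reflect … .reflect`), the STATE of the cascade (model balls known
present / saturated / with known dozen / known absent, the designated unsaturated contact of the end ball), the certificate language `Cert` (E1 node,
saturation split, free-ball node, twin-vacancy leaf, witnessed conflict leaf) and the checker `run`.  Soundness is '…SeamFullCensusSound'; the certificate
and the census theorem '…SeamFullCensusCert'.
WHAT THIS IS NOT: nothing is proved here; F-C1 not moved.
-/

namespace Summit.Ventures.Crystal3D.Theorems

namespace TailResidue

namespace FullCensus

open Summit.Ventures.Crystal3D EndRowFloor NearIdentity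

/-! ### Rational triples -/

/-- A rational triple (model vector at scale `√18`). -/
structure Q3 where
  /-- first cubic coordinate -/
  x : ℚ
  /-- second cubic coordinate -/
  y : ℚ
  /-- third cubic coordinate -/
  z : ℚ
  deriving DecidableEq

namespace Q3

/-- Sum. -/
def add (a b : Q3) : Q3 := ⟨a.x + b.x, a.y + b.y, a.z + b.z⟩
/-- Difference. -/
def sub (a b : Q3) : Q3 := ⟨a.x - b.x, a.y - b.y, a.z - b.z⟩
/-- Scalar multiple. -/
def smul (r : ℚ) (a : Q3) : Q3 := ⟨r * a.x, r * a.y, r * a.z⟩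
/-- Dot product. -/
def dot (a b : Q3) : ℚ := a.x * b.x + a.y * b.y + a.z * b.z
/-- Squared distance. -/
def d2 (a b : Q3) : ℚ := dot (sub a b) (sub a b)
/-- Back to the model vectors of '…EndRowRatFrames'. -/
def toV (a : Q3) : Fin 3 → ℚ := ![a.x, a.y, a.z]
/-- Swap of the first two coordinates (the symmetry `x ↔ y` of the configuration). -/
def swap (a : Q3) : Q3 := ⟨a.y, a.x, a.z⟩

end Q3

/-- The twelve model slots `slotInt` as triples (same order). -/
def slotQ3 : List Q3 :=
  [⟨1, 1, 0⟩, ⟨1, -1, 0⟩, ⟨-1, 1, 0⟩, ⟨-1, -1, 0⟩, ⟨1, 0, 1⟩, ⟨1, 0, -1⟩, ⟨-1, 0, 1⟩, ⟨-1, 0, -1⟩, ⟨0, 1, 1⟩, ⟨0, 1, -1⟩, ⟨0, -1, 1⟩, ⟨0, -1, -1⟩]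

/-- The eight cube normals `cubeInt` as triples (same order). -/
def cubeQ3 : List Q3 :=
  [⟨1, 1, 1⟩, ⟨1, 1, -1⟩, ⟨1, -1, 1⟩, ⟨1, -1, -1⟩, ⟨-1, 1, 1⟩, ⟨-1, 1, -1⟩, ⟨-1, -1, 1⟩, ⟨-1, -1, -1⟩]

/-- Slot `i` (as a triple). -/
def slt (i : ℕ) : Q3 := slotQ3.getD i ⟨0, 0, 0⟩
/-- Cube normal `c` (as a triple). -/
def cub (c : ℕ) : Q3 := cubeQ3.getD c ⟨0, 0, 0⟩

/-! ### Frame tables of a reflection chain -/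

/-- The rational reflection `v ↦ v − (2(v·n)/3) n` (`rq`). -/
def rq3 (n v : Q3) : Q3 := Q3.sub v (Q3.smul (2 * Q3.dot v n / 3) n)

/-- One reflection step on the pair of tables `(g, w)` (slot images, menu vectors): reflect everything across the current `c`-th menu vector. -/
def tabStep (t : List Q3 × List Q3) (c : ℕ) : List Q3 × List Q3 :=
  let n := t.2.getD c ⟨0, 0, 0⟩
  (t.1.map (rq3 n), t.2.map (rq3 n))

/-- Base tables: slot images `3 sᵢ`, menu vectors `cubeInt c`. -/
def tabBase : List Q3 × List Q3 := (slotQ3.map (Q3.smul 3), cubeQ3)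

/-- The tables of the frame reached from the base frame by the reflection chain `κ`. -/
def tabs (κ : List ℕ) : List Q3 × List Q3 := κ.foldl tabStep tabBase

/-- Slot image `i` of the tables. -/
def gOf (t : List Q3 × List Q3) (i : ℕ) : Q3 := t.1.getD i ⟨0, 0, 0⟩
/-- Menu vector `c` of the tables. -/
def wOf (t : List Q3 × List Q3) (c : ℕ) : Q3 := t.2.getD c ⟨0, 0, 0⟩

/-- Integer menu value `slotInt i · cubeInt c`. -/
def sc (i c : ℕ) : ℚ := Q3.dot (slt i) (cub c)
/-- `slotInt i · slotInt j`. -/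
def ss (i j : ℕ) : ℚ := Q3.dot (slt i) (slt j)

/-- The mirror position `g i − 2 (sᵢ·c) w c` (`mirQ`). -/
def mir3 (t : List Q3 × List Q3) (i c : ℕ) : Q3 := Q3.sub (gOf t i) (Q3.smul (2 * sc i c) (wOf t c))

/-- The twelve slot balls of `p`. -/
def fullList (t : List Q3 × List Q3) (p : Q3) : List Q3 := (List.range 12).map fun i => Q3.add p (gOf t i)
/-- Own slot balls of the twin reading `c` (`sᵢ·c ≤ 0`). -/
def ownList (t : List Q3 × List Q3) (p : Q3) (c : ℕ) : List Q3 := ((List.range 12).filter fun i => decide (sc i c ≤ 0)).map fun i => Q3.add p (gOf t i)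
/-- Mirror balls of the twin reading `c` (`sᵢ·c < 0`). -/
def mirList (t : List Q3 × List Q3) (p : Q3) (c : ℕ) : List Q3 := ((List.range 12).filter fun i => decide (sc i c < 0)).map fun i => Q3.add p (mir3 t i c)
/-- Far slots of the twin reading `c` (`sᵢ·c > 0`), forced empty. -/
def farList (t : List Q3 × List Q3) (p : Q3) (c : ℕ) : List Q3 := ((List.range 12).filter fun i => decide (0 < sc i c)).map fun i => Q3.add p (gOf t i)
/-- Cube normals keeping the closed star of slot `j` on the own side. -/
def ownSide (j c : ℕ) : Bool := (List.range 12).all fun i => !decide (0 < ss i j) || decide (sc i c ≤ 0)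

/-! ### States, witnesses, certificates -/

/-- The end ball `b = q + 3·slot 0 = (3,3,0)`. -/
def bQ : Q3 := ⟨3, 3, 0⟩

/-- A state of the cascade. -/
structure St where
  /-- balls known to be in `X` -/
  pres : List Q3
  /-- balls known to have twelve contacts -/
  sat : List Q3
  /-- balls with a known dozen: every contact of the ball is in the list -/
  dzn : List (Q3 × List Q3)
  /-- positions known NOT to carry a ball of `X` -/
  emp : List Q3
  /-- the designated unsaturated contact of the end ball, if chosen -/
  uns : Option Q3

/-- Insert if absent. -/
def insertV (v : Q3) (L : List Q3) : List Q3 := if v ∈ L then L else v :: L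
/-- Insert all. -/
def addAll (L : List Q3) (vs : List Q3) : List Q3 := vs.foldr insertV L

/-- Record the FULL dozen of `p` (frame chain `κ`). -/
def addFull (st : St) (p : Q3) (κ : List ℕ) : St :=
  { st with pres := addAll st.pres (fullList (tabs κ) p), dzn := (p, fullList (tabs κ) p) :: st.dzn }

/-- Record the TWIN dozen `c` of `p` (frame chain `κ`). -/
def addTwin (st : St) (p : Q3) (κ : List ℕ) (c : ℕ) : St :=
  { st with pres := addAll st.pres (ownList (tabs κ) p c ++ mirList (tabs κ) p c),
            dzn := (p, ownList (tabs κ) p c ++ mirList (tabs κ) p c) :: st.dzn, emp := farList (tabs κ) p c ++ st.emp }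

/-- The closed star of slot `j` at `p` is present. -/
def starOK (st : St) (t : List Q3 × List Q3) (p : Q3) (j : ℕ) : Bool :=
  (List.range 12).all fun i => !decide (0 < ss i j) || decide (Q3.add p (gOf t i) ∈ st.pres)

/-- A witnessed contradiction of a state. -/
inductive Witness where
  /-- two present balls closer than `1` -/
  | sep : Q3 → Q3 → Witness
  /-- a present ball at a forced-empty position -/
  | emp : Q3 → Witness
  /-- a present ball at distance `1` from a ball with known dozen, outside the dozen -/
  | dzn : Q3 → Q3 → Witness
  /-- a present ball strictly inside the `5/4`-gap of a saturated ball -/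
  | gap : Q3 → Q3 → Witness
  /-- twelve present contacts of the end ball -/
  | count : Witness

/-- Checking a witness. -/
def checkW (st : St) : Witness → Bool
  | .sep u v => decide (u ∈ st.pres) && decide (v ∈ st.pres) && decide (u ≠ v) && decide (Q3.d2 u v < 18)
  | .emp u => decide (u ∈ st.pres) && decide (u ∈ st.emp)
  | .dzn p x => decide (x ∈ st.pres) && decide (Q3.d2 x p = 18) && st.dzn.any fun pd => decide (pd.1 = p) && !decide (x ∈ pd.2)
  | .gap p x => decide (p ∈ st.sat) && decide (x ∈ st.pres) && decide (18 < Q3.d2 p x) && decide (Q3.d2 p x < 225 / 8)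
  | .count => decide (12 ≤ (st.pres.filter fun v => decide (Q3.d2 bQ v = 18)).length)

/-- The reader `q = 0` and the four common neighbours of `q` and `b`. -/
def kList : List Q3 := [⟨0, 0, 0⟩, ⟨3, 0, 3⟩, ⟨3, 0, -3⟩, ⟨0, 3, 3⟩, ⟨0, 3, -3⟩]
/-- The four balls of the free-ball pattern that are saturated (variant `σ`). -/
def sList (σ : ℚ) : List Q3 := [⟨6, 0, 0⟩, ⟨0, 6, 0⟩, ⟨6, 3, 3 * σ⟩, ⟨3, 6, 3 * σ⟩]
/-- The designated unsaturated mirror ball `b + (1,1,−4σ)`. -/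
def m0 (σ : ℚ) : Q3 := ⟨4, 4, -4 * σ⟩
/-- The ten known contacts of `b` in the free-ball pattern. -/
def tenList (σ : ℚ) : List Q3 := kList ++ sList σ ++ [m0 σ]
/-- The three candidate positions of the eleventh contact. -/
def candList (σ : ℚ) : List Q3 := [⟨6, 6, 0⟩, ⟨4, 7, -σ⟩, ⟨7, 4, -σ⟩]
/-- The eleven balls of the twin-vacancy leaf: the twin dozen of `b` for the normal `(1,1,−σ)` minus the mirror `b + (4,1,−σ)`. -/
def elevenList (σ : ℚ) : List Q3 := tenList σ ++ [⟨4, 7, -σ⟩]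

/-- The free-ball pattern (variant `σ`). -/
def freePattern (st : St) (σ : ℚ) : Bool :=
  decide (∀ v ∈ tenList σ, v ∈ st.pres) &&
  decide (∀ v ∈ st.pres, Q3.d2 bQ v = 18 → v ∈ tenList σ) &&
  decide (∀ k ∈ kList, ∃ pd ∈ st.dzn, pd.1 = k ∧ ∀ u ∈ pd.2, Q3.d2 bQ u = 18 → u ∈ tenList σ) &&
  decide (∀ v ∈ sList σ, v ∈ st.sat) &&
  decide (st.uns = some (m0 σ))

/-- The twin-vacancy pattern (variant `σ`, optionally swapped `x ↔ y`). -/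
def vacPattern (st : St) (σ : ℚ) (sw : Bool) : Bool :=
  decide (∀ v ∈ elevenList σ, (if sw then v.swap else v) ∈ st.pres)

/-- Certificates. -/
inductive Cert where
  /-- close by a witnessed conflict -/
  | leaf : Witness → Cert
  /-- E1 at the saturated ball `p`, frame chain `κ`, star slot `j`; children: FULL, first own-side twin, second own-side twin -/
  | e1 : Q3 → List ℕ → ℕ → Cert → Cert → Cert → Cert
  /-- saturation split at the contact `x` of the end ball; children: `x` designated unsaturated, `x` saturated -/
  | split : Q3 → Cert → Cert → Cert
  /-- free-ball step (variant `σ`); children for the three candidates -/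
  | free : ℚ → Cert → Cert → Cert → Cert
  /-- twin-vacancy leaf (variant `σ`, swap flag) -/
  | vac : ℚ → Bool → Cert

/-- **THE CHECKER.** -/
def run : Cert → St → Bool
  | .leaf w, st => checkW st w
  | .e1 p κ j kF k1 k2, st =>
    decide (j < 12) && decide (p ∈ st.sat) && starOK st (tabs κ) p j && run kF (addFull st p κ) &&
      (match (List.range 8).filter (ownSide j) with
       | [c₁, c₂] => run k1 (addTwin st p κ c₁) && run k2 (addTwin st p κ c₂)
       | _ => false)
  | .split x kU kS, st =>
    decide (x ∈ st.pres) && decide (Q3.d2 bQ x = 18) && !decide (st.uns = some x) &&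
      (match st.uns with
       | none => run kU { st with uns := some x }
       | some _ => true) &&
      run kS { st with sat := x :: st.sat }
  | .free σ k1 k2 k3, st =>
    (decide (σ = 1) || decide (σ = -1)) && freePattern st σ &&
      run k1 { st with pres := insertV ⟨6, 6, 0⟩ st.pres } &&
      run k2 { st with pres := insertV ⟨4, 7, -σ⟩ st.pres } &&
      run k3 { st with pres := insertV ⟨7, 4, -σ⟩ st.pres }
  | .vac σ sw, st => (decide (σ = 1) || decide (σ = -1)) && vacPattern st σ sw

/-- The initial state: the reader `q = 0` FULL in the base frame. -/
def initSt : St :=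
  { pres := addAll [⟨0, 0, 0⟩] (fullList tabBase ⟨0, 0, 0⟩), sat := [⟨0, 0, 0⟩], dzn := [(⟨0, 0, 0⟩, fullList tabBase ⟨0, 0, 0⟩)], emp := [],
    uns := none }

end FullCensus

end TailResidue

end Summit.Ventures.Crystal3D.Theorems
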